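import Mathlib
import Literature.NumberTheory.LFunctions.MultiplicativeAutomatic

/-!
# Digit-sum classes are `2`-automatic (stub `isAutomaticSeq_of_digitWeight`, line Sketch)

Support file for the crux `Summit.QuantumAdvantage.QuantumAdvantage.Theses.MobiusLadder.DigitPolyUniformity`
(item `stmt-QuantumAdvantage-1392`), automatic-phase class: SYMMETRIC low-degree `𝔽₂`-polynomial
phases of the binary digits of `N` are functions of the binary digit sum `s₂(N)` modulo a power of
`2`, and such "digit-sum-class" sequences `N ↦ g (s₂(N) mod m)` are `2`-automatic in the kernel
sense of `Literature.NumberTheory.LFunctions.IsAutomaticSeq` (finite `2`-kernel), hence fall under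
Müllner's theorem (automatic ⇒ orthogonal to Möbius / Liouville).

The digit sum `w` is pinned down abstractly by the hypothesis
`∀ N M, N < 2 ^ M → w N = #{i < M | N.testBit i}`; the proof is the additivity
`w (2^i n + r) = w r + w n` (`r < 2^i`), from which every `2`-kernel element of
`N ↦ g (w N % m)` is one of the `m` sequences `n ↦ g ((w n + s) % m)`, `s < m`.
-/

set_option linter.dupNamespace false -- D-0017: single-problem summit ⇒ QuantumAdvantage.QuantumAdvantage by design

namespace Summit.QuantumAdvantage.QuantumAdvantage.Theorems.MobiusLadder

namespace DigitWeight

/-- `2 ^ i * n + r < 2 ^ (i + n)` for `r < 2 ^ i` (room for the digits of `n` above position `i`).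
[folklore] -/
theorem two_pow_mul_add_lt {i n r : ℕ} (hr : r < 2 ^ i) : 2 ^ i * n + r < 2 ^ (i + n) := by
  have hn : n + 1 ≤ 2 ^ n := Nat.lt_two_pow_self
  calc 2 ^ i * n + r < 2 ^ i * n + 2 ^ i := by omega
    _ = 2 ^ i * (n + 1) := by ring
    _ ≤ 2 ^ i * 2 ^ n := Nat.mul_le_mul_left _ hn
    _ = 2 ^ (i + n) := by rw [pow_add]

/-- **Additivity of the binary digit sum over concatenation**: if `w N` is the number of set bits of
`N` (among any `M` positions with `N < 2 ^ M`), then `w (2 ^ i * n + r) = w r + w n` for `r < 2 ^ i`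
(the low `i` digits of `2 ^ i * n + r` are those of `r`, the higher ones those of `n`). [folklore] -/
theorem weight_two_pow_mul_add (w : ℕ → ℕ)
    (hw : ∀ N M : ℕ, N < 2 ^ M → w N = ((Finset.range M).filter fun i => N.testBit i).card)
    {i r : ℕ} (n : ℕ) (hr : r < 2 ^ i) : w (2 ^ i * n + r) = w r + w n := by
  rw [hw _ _ (two_pow_mul_add_lt (n := n) hr), hw r i hr, hw n n Nat.lt_two_pow_self,
    Finset.card_filter, Finset.card_filter, Finset.card_filter, Finset.sum_range_add]
  congr 1
  · refine Finset.sum_congr rfl fun j hj => ?_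
    rw [Nat.testBit_two_pow_mul_add _ hr, if_pos (Finset.mem_range.mp hj)]
  · refine Finset.sum_congr rfl fun j _ => ?_
    rw [Nat.testBit_two_pow_mul_add _ hr, if_neg (show ¬ (i + j < i) by omega),
      Nat.add_sub_cancel_left]

/-- The `2`-kernel of a digit-sum class `N ↦ g (w N % m)` (`0 < m`) is contained in the `m`
translates `n ↦ g ((w n + s) % m)`, `s : Fin m`. [folklore] -/
theorem qKernel_subset_range {m : ℕ} (hm : 0 < m) (w : ℕ → ℕ)
    (hw : ∀ N M : ℕ, N < 2 ^ M → w N = ((Finset.range M).filter fun i => N.testBit i).card)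
    (g : ℕ → ℂ) :
    Literature.NumberTheory.LFunctions.qKernel 2 (fun N => g (w N % m)) ⊆
      Set.range (fun s : Fin m => fun n => g ((w n + (s : ℕ)) % m)) := by
  rintro f ⟨i, -, r, hr, rfl⟩
  refine ⟨⟨w r % m, Nat.mod_lt _ hm⟩, ?_⟩
  funext n
  simp only [weight_two_pow_mul_add w hw n hr, Nat.add_mod_mod, Nat.add_comm (w n) (w r)]

end DigitWeight

/-- **Digit-sum classes are `2`-automatic.** If `w : ℕ → ℕ` is the binary digit sum (pinned down
by `w N = #{i < M | N.testBit i}` whenever `N < 2 ^ M`), then for every `m > 0` and every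
`g : ℕ → ℂ` the sequence `N ↦ g (w N % m)` has finite `2`-kernel: by additivity
`w (2 ^ i * n + r) = w r + w n` each kernel element is `n ↦ g ((w n + s) % m)` for some `s < m`.
[folklore] -/
theorem isAutomaticSeq_of_digitWeight : ∀ m : ℕ, 0 < m → ∀ w : ℕ → ℕ, (∀ N M : ℕ, N < 2 ^ M → w N = ((Finset.range M).filter fun i => N.testBit i).card) → ∀ g : ℕ → ℂ, Literature.NumberTheory.LFunctions.IsAutomaticSeq 2 (fun N => g (w N % m)) :=
  fun _m hm w hw g =>
    (Set.finite_range _).subset (DigitWeight.qKernel_subset_range hm w hw g)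

end Summit.QuantumAdvantage.QuantumAdvantage.Theorems.MobiusLadder
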